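import Literature.NumberTheory.EllipticCurves.HeegnerPointsKolyvaginVisibleDescentProofs
import HarnessLib

/-!
# Kolyvagin's bound on the order of `Ш`: the Cassels–Tate telescope for VISIBLE split data
# (any prime `p`; the form instantiable at `p = 2`)

Visible twin of `HeegnerPointsKolyvaginSplitDescentTelescopePureProofs` (McCallum 1991, §1 Theorem
with Thm. 5.4 "≤" and Cor. 5.6 in TELESCOPE form, **`∑ᵢ Nᵢ ≤ M₀`**, for the split data
`KolyvaginDescent.SplitHypothesesM`, Čebotarev in kernel form for pure classes). That file's input
`hCeb` — McCallum's Prop. 3.1 in kernel form: a Kolyvagin prime `ℓ` with `g_λ = 0 ⟺ g ∈ ⟨T⟩` for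
every pure `g ∈ ⟨g₁, g₂, T⟩` — is, like the product-form Cor. 3.2, NOT dischargeable at `p = 2` for
the pair `(E, E^D)` over `ℚ` without a VISIBILITY hypothesis on the span (entangled bottom bits,
`E[2] = E^D[2]`, and the inflated class `ξ_E` have tied resp. zero localisations at every
Kolyvagin prime; see `HeegnerPointsKolyvaginVisibleDescentProofs`). This file runs the same
telescope for the VISIBLE data `KolyvaginDescent.VisibleSplitHypothesesM` (restriction map
`rK : V →+ H` to `K(E_{p^M})`, factorisation of the local condition at Kolyvagin primes, visible
Selmer group) with Prop. 3.1 in the form that IS provable at `2` from the tree's character-form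
Step B and criterion (`GenusExact.exists_h1Eval_conj_mul_character_signStable`,
`exists_kolyvaginPrime_gt_two_criterion`, BSD route `GenusKolyvaginAtTwo`):

* `hCeb` (visible kernel form, TWO RAYS): for `g₁ ∈ V^{ν}`, `g₂ ∈ V^{-ν}`, `T` pure and
  `rK` INJECTIVE ON `⟨g₁, g₂, T⟩` (McCallum p. 299: restriction to `K(E_{p^M})` injective on the
  span — the hypothesis under which Prop. 3.1's evaluation argument runs), a Kolyvagin prime
  `ℓ > b` with `T_λ = 0` and, on the two rays, `p^j g_{i,λ} = 0 ⟺ p^j g_i ∈ ⟨T⟩` (the telescope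
  uses the kernel condition only on `⟨c(n_k)⟩`, `⟨s_{k+1}⟩` and `T`; a character with these
  kernels on two rays always exists, for mixed classes it need not);
* the injectivity of `rK` on each span `⟨s_{k+1}, c(n_k), T⟩` met in the induction is PROVED here
  (`eq_zero_of_mem_closure_of_rK_eq_zero`, from the tie lemma
  `VisibleSplitHypothesesM.eq_zero_of_rK_eq`: the span is "Selmer classes of sign `ν`" + "a class
  supported on Kolyvagin primes plus Selmer classes, of sign `-ν`"), given that Kolyvagin's classes
  are supported on Kolyvagin places (`hcsupp`, Lemma 4.3 — for square-free `n` with several prime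
  factors this is a hypothesis here, the structure's `dv_mul` covering two factors only).

Results (proof text of the sibling, McCallum's induction (16)–(23) with invariant (I)):
`VisibleSplitHypothesesM.exists_chain_of_casselsTate` (the chain `n_k = ℓ₁⋯ℓ_k`),
`VisibleSplitHypothesesM.sum_expo_le_M₀_of_casselsTate` (**`∑ᵢ expo sᵢ ≤ M₀`**). At `2` for a
visible pair: `#Ш(E/ℚ)_{2^∞} · #Ш(E^{(d_K)}/ℚ)_{2^∞} ≤ 4^{M₀}` once the two symplectic counts are
made (sibling `…VisibleDescentOrderProofs`). No definition, no named fact; nothing here is a claim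
about BSD.

## References

* W. G. McCallum, *Kolyvagin's work on Shafarevich–Tate groups*, LMS LNS 153 (1991), 295–316:
  §1 Theorem, p. 299, Prop. 3.1 / Cor. 3.2, Prop. 4.4, Lemma 4.6, Prop. 4.7, Lemma 5.1, Lemma 5.3,
  Thm. 5.4 and its proof ((16)–(23)), Cor. 5.6. [McCallumLMS1991]
* B. H. Gross, *Kolyvagin's work on modular elliptic curves*, same volume: Prop. 9.1.
  [GrossLMS1991]
* V. A. Kolyvagin, Izv. 1989, §3 (the pair `(E, E^D)` over `ℚ` at `l = 2`). [Kolyvagin1989Izv]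
-/

open scoped Classical

namespace Literature.NumberTheory.EllipticCurves

namespace KolyvaginDescent

namespace VisibleSplitHypothesesM

variable {V : Type*} [AddCommGroup V] {Pl : Type*} {H : Type*} [AddCommGroup H]
variable (S : VisibleSplitHypothesesM V Pl H)

/-! ### Plumbing (the sibling's order lemmas, restated for this file) -/

/-- `x` has order exactly `p^M`: `k • x = 0 ↔ p^M ∣ k`. [folklore] -/
private theorem zsmul_x_eq_zero_iff' (k : ℤ) : k • S.x = 0 ↔ ((S.p : ℤ) ^ S.M) ∣ k :=
  zsmul_eq_zero_iff_prime_pow_dvd S.hp (S.torsion S.x) S.x_ord k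

/-- `p^{expo s} • s = 0`. [folklore] -/
private theorem pow_expo_zsmul' (s : V) : ((S.p : ℤ) ^ S.expo s) • s = 0 := by
  have h : ∃ a : ℕ, ((S.p : ℤ) ^ a) • s = 0 := ⟨S.M, S.torsion s⟩
  exact Nat.find_spec h

/-- `p^{expo s - 1} • s ≠ 0` when `expo s ≠ 0`. [folklore] -/
private theorem pow_expo_sub_one_zsmul_ne_zero' {s : V} (h : S.expo s ≠ 0) :
    ((S.p : ℤ) ^ (S.expo s - 1)) • s ≠ 0 := by
  have h' : ∃ a : ℕ, ((S.p : ℤ) ^ a) • s = 0 := ⟨S.M, S.torsion s⟩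
  have hlt : S.expo s - 1 < Nat.find h' := Nat.sub_one_lt h
  exact Nat.find_min h' hlt

/-! ### Square-free products with one more Kolyvagin prime -/

/-- `ℓ n ∈ S_{r+1}` for `n ∈ S_r` and a Kolyvagin prime `ℓ ∤ n`. [folklore] -/
private theorem kolSupp_mul_of_not_dvd {ℓ n : ℕ} (hℓ : S.Kol ℓ) (hn : KolSupp S.Kol n) (hℓn : ¬ ℓ ∣ n) :
    KolSupp S.Kol (ℓ * n) := by
  have hℓp := S.prime_of_kol ℓ hℓ
  refine ⟨?_, fun q hq ↦ ?_⟩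
  · rw [Nat.squarefree_mul_iff]
    exact ⟨(Nat.Prime.coprime_iff_not_dvd hℓp).mpr hℓn, hℓp.squarefree, hn.1⟩
  · rw [Nat.primeFactors_mul hℓp.ne_zero hn.1.ne_zero, Finset.mem_union, hℓp.primeFactors,
      Finset.mem_singleton] at hq
    rcases hq with rfl | hq
    · exact hℓ
    · exact hn.2 q hq

/-- `ℓ n` has one more prime factor than `n` (`ℓ ∤ n`). [folklore] -/
private theorem card_primeFactors_mul_of_not_dvd {ℓ n : ℕ} (hℓ : ℓ.Prime) (hn : n ≠ 0) (hℓn : ¬ ℓ ∣ n) :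
    (ℓ * n).primeFactors.card = n.primeFactors.card + 1 := by
  rw [Nat.primeFactors_mul hℓ.ne_zero hn, hℓ.primeFactors, ← Finset.insert_eq,
    Finset.card_insert_of_notMem fun h ↦ hℓn (Nat.dvd_of_mem_primeFactors h)]

/-- The signs `ε_i = ε (-1)^i` are `±1`. [folklore] -/
private theorem sign_pow_cases' (i : ℕ) : S.ε * (-1) ^ i = 1 ∨ S.ε * (-1) ^ i = -1 := by
  rcases S.hε with h | h <;> rcases neg_one_pow_eq_or ℤ i with h' | h' <;> simp [h, h']

/-! ### Elements of the span of finitely many members of a family -/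

/-- An element of the subgroup generated by `{s i : i ∈ I}` is a `ℤ`-combination of the `s i`.
[folklore] -/
private theorem exists_sum_of_mem_closure_image (s : ℕ → V) (I : Finset ℕ) {v : V}
    (hv : v ∈ AddSubgroup.closure ((I.image s : Finset V) : Set V)) :
    ∃ a : ℕ → ℤ, v = ∑ i ∈ I, a i • s i := by
  induction hv using AddSubgroup.closure_induction with
  | mem w hw =>
    rw [Finset.coe_image, Set.mem_image] at hw
    obtain ⟨i, hi, rfl⟩ := hw
    rw [Finset.mem_coe] at hi
    refine ⟨fun j ↦ if j = i then 1 else 0, ?_⟩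
    simp only [ite_smul, one_smul, zero_smul, Finset.sum_ite_eq', hi, if_true]
  | zero => exact ⟨0, by simp⟩
  | add w w' _ _ hw hw' =>
    obtain ⟨a, rfl⟩ := hw
    obtain ⟨a', rfl⟩ := hw'
    exact ⟨a + a', by simp only [Pi.add_apply, add_smul, Finset.sum_add_distrib]⟩
  | neg w _ hw =>
    obtain ⟨a, rfl⟩ := hw
    exact ⟨-a, by simp only [Pi.neg_apply, neg_smul, Finset.sum_neg_distrib]⟩

/-- Independence of `x, s₁, …, s_K` as a flag condition: `a s_k ∈ ⟨s_j : k < j ≤ K⟩ ⟹ a s_k = 0`.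
[folklore] -/
private theorem zsmul_eq_zero_of_mem_closure_Ioc {K : ℕ} {s : ℕ → V}
    (hind : ∀ (b : ℤ) (a : ℕ → ℤ), b • S.x + ∑ i ∈ Finset.Ioc 0 K, a i • s i = 0 →
      b • S.x = 0 ∧ ∀ i ∈ Finset.Ioc 0 K, a i • s i = 0)
    {k : ℕ} (hk : k ∈ Finset.Ioc 0 K) {a : ℤ}
    (h : a • s k ∈ AddSubgroup.closure (((Finset.Ioc k K).image s : Finset V) : Set V)) :
    a • s k = 0 := by
  obtain ⟨c, hc⟩ := exists_sum_of_mem_closure_image s _ h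
  have hkk : k ∉ Finset.Ioc k K := by simp
  have hsub : Finset.Ioc 0 K ∩ Finset.Ioc k K = Finset.Ioc k K := by
    apply Finset.inter_eq_right.mpr
    intro i hi
    simp only [Finset.mem_Ioc] at hi hk ⊢
    omega
  set a' : ℕ → ℤ := fun i ↦ (if i = k then a else 0) + (if i ∈ Finset.Ioc k K then -c i else 0)
    with ha'
  have hrel : (0 : ℤ) • S.x + ∑ i ∈ Finset.Ioc 0 K, a' i • s i = 0 := by
    have h1 : ∀ i, a' i • s i =
        (if i = k then a • s i else 0) + (if i ∈ Finset.Ioc k K then (-c i) • s i else 0) := by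
      intro i
      simp only [ha', add_smul, ite_smul, zero_smul]
    simp only [zero_smul, zero_add, h1, Finset.sum_add_distrib, Finset.sum_ite_eq', hk, if_true,
      Finset.sum_ite_mem, hsub, neg_smul, Finset.sum_neg_distrib, ← hc, add_neg_cancel]
  have := (hind 0 a' hrel).2 k hk
  simpa [ha', hkk] using this

/-- Independence of `x, s₁, …, s_K` as a flag condition at `x`: `b x ∈ ⟨s_j : 0 < j ≤ K⟩ ⟹ b x = 0`.
[folklore] -/
private theorem zsmul_x_eq_zero_of_mem_closure_Ioc {K : ℕ} {s : ℕ → V}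
    (hind : ∀ (b : ℤ) (a : ℕ → ℤ), b • S.x + ∑ i ∈ Finset.Ioc 0 K, a i • s i = 0 →
      b • S.x = 0 ∧ ∀ i ∈ Finset.Ioc 0 K, a i • s i = 0)
    {b : ℤ} (h : b • S.x ∈ AddSubgroup.closure (((Finset.Ioc 0 K).image s : Finset V) : Set V)) :
    b • S.x = 0 := by
  obtain ⟨c, hc⟩ := exists_sum_of_mem_closure_image s _ h
  have hrel : b • S.x + ∑ i ∈ Finset.Ioc 0 K, (-c i) • s i = 0 := by
    simp only [neg_smul, Finset.sum_neg_distrib, ← hc, add_neg_cancel]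
  exact (hind b (fun i ↦ -c i) hrel).1

/-! ### Isotropy along a span -/

/-- If `t` pairs to zero with every member of `T ⊆ Sel`, it pairs to zero with `⟨T⟩`. [folklore] -/
private theorem pairing_eq_zero_of_mem_closure {R : Type*} [AddCommGroup R] (P : S.Sel →+ S.Sel →+ R)
    {T : Set V} (hT : T ⊆ S.Sel) {t : V} (ht : t ∈ S.Sel)
    (h0 : ∀ w, ∀ hw : w ∈ T, P ⟨w, hT hw⟩ ⟨t, ht⟩ = 0)
    {w : V} (hw : w ∈ AddSubgroup.closure T) (hwS : w ∈ S.Sel) :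
    P ⟨w, hwS⟩ ⟨t, ht⟩ = 0 := by
  have hle : AddSubgroup.closure T ≤ S.Sel := (AddSubgroup.closure_le _).mpr hT
  revert hwS
  induction hw using AddSubgroup.closure_induction with
  | mem w h => exact fun _ ↦ h0 w h
  | zero => exact fun h ↦ by rw [show (⟨0, h⟩ : S.Sel) = 0 from rfl, map_zero, AddMonoidHom.zero_apply]
  | add w w' hw hw' ih ih' =>
    intro h
    have : (⟨w + w', h⟩ : S.Sel) = ⟨w, hle hw⟩ + ⟨w', hle hw'⟩ := rfl
    rw [this, map_add, AddMonoidHom.add_apply, ih (hle hw), ih' (hle hw'), add_zero]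
  | neg w hw ih =>
    intro h
    rw [show (⟨-w, h⟩ : S.Sel) = -⟨w, hle hw⟩ from rfl, map_neg, AddMonoidHom.neg_apply, ih (hle hw),
      neg_zero]

/-! ### Visibility of the spans `⟨s_{k+1}, c(n_k), T⟩` met in the induction -/

/-- The shape of an element of `⟨g₁, g₂, T⟩` (`g₁ ∈ Sel ∩ V^{ν}`, `g₂ ∈ V^{-ν}` supported on
Kolyvagin places, `T ⊆ Sel` pure): `u + w` with `u ∈ Sel ∩ V^{ν}` and `w ∈ V^{-ν}` supported on
Kolyvagin places. [folklore] -/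
private theorem exists_shape_of_mem_closure {ν : ℤ} (hν : ν = 1 ∨ ν = -1) {g₁ g₂ : V}
    (hg₁ : g₁ ∈ S.Sel) (hg₁ν : g₁ ∈ S.part ν) (hg₂ν : g₂ ∈ S.part (-ν))
    (hg₂ : ∀ v, (∀ q, S.Kol q → v ≠ S.pl q) → g₂ ∈ S.Loc v) {T : Finset V}
    (hT : ∀ t ∈ T, t ∈ S.Sel) (hTp : ∀ t ∈ T, ∃ e : ℤ, (e = 1 ∨ e = -1) ∧ t ∈ S.part e) {g : V}
    (hg : g ∈ AddSubgroup.closure (insert g₁ (insert g₂ (T : Set V)))) :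
    ∃ u w : V, u ∈ S.Sel ∧ u ∈ S.part ν ∧ w ∈ S.part (-ν) ∧
      (∀ v, (∀ q, S.Kol q → v ≠ S.pl q) → w ∈ S.Loc v) ∧ g = u + w := by
  induction hg using AddSubgroup.closure_induction with
  | mem z hz =>
    rcases hz with rfl | hz
    · exact ⟨z, 0, hg₁, hg₁ν, zero_mem _, fun v _ ↦ zero_mem _, by rw [add_zero]⟩
    rcases hz with rfl | hz
    · exact ⟨0, z, zero_mem _, zero_mem _, hg₂ν, hg₂, by rw [zero_add]⟩
    · have hzS : z ∈ S.Sel := hT z hz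
      have hzLoc : ∀ v, (∀ q, S.Kol q → v ≠ S.pl q) → z ∈ S.Loc v := fun v _ ↦
        (S.mem_sel_iff z).mp hzS v
      obtain ⟨e, he, hze⟩ := hTp z hz
      by_cases heν : e = ν
      · subst heν
        exact ⟨z, 0, hzS, hze, zero_mem _, fun v _ ↦ zero_mem _, by rw [add_zero]⟩
      · have heν' : e = -ν := by
          rcases he with rfl | rfl <;> rcases hν with rfl | rfl <;> simp_all
        subst heν'
        exact ⟨0, z, zero_mem _, zero_mem _, hze, hzLoc, by rw [zero_add]⟩
  | zero => exact ⟨0, 0, zero_mem _, zero_mem _, zero_mem _, fun v _ ↦ zero_mem _, by rw [add_zero]⟩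
  | add a b _ _ ha hb =>
    obtain ⟨u, w, hu, huν, hwν, hw, rfl⟩ := ha
    obtain ⟨u', w', hu', hu'ν, hw'ν, hw', rfl⟩ := hb
    exact ⟨u + u', w + w', add_mem hu hu', add_mem huν hu'ν, add_mem hwν hw'ν,
      fun v hv ↦ add_mem (hw v hv) (hw' v hv), by abel⟩
  | neg a _ ha =>
    obtain ⟨u, w, hu, huν, hwν, hw, rfl⟩ := ha
    exact ⟨-u, -w, neg_mem hu, neg_mem huν, neg_mem hwν, fun v hv ↦ neg_mem (hw v hv), by abel⟩

/-- **`rK` is injective on `⟨g₁, g₂, T⟩`** for `g₁ ∈ Sel ∩ V^{ν}`, `g₂ ∈ V^{-ν}` supported on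
Kolyvagin places (Selmer at every place which is not the place of a Kolyvagin prime — every
Kolyvagin class `c(n)` is such, Lemma 4.3) and `T ⊆ Sel` pure: every `g` in the span is `u + w`
with `u ∈ Sel ∩ V^{ν}` and `w ∈ V^{-ν}` supported on Kolyvagin places, so `rK g = 0` gives
`rK u = rK (-w)` and the tie lemma (`VisibleSplitHypothesesM.eq_zero_of_rK_eq`) kills both. This
discharges the visibility precondition of the kernel-form Čebotarev at every step of McCallum's
induction. [cite: McCallumLMS1991, §3 (p. 299), Lemma 4.3] [cite: GrossLMS1991, Prop. 9.1] -/
theorem eq_zero_of_mem_closure_of_rK_eq_zero {ν : ℤ} (hν : ν = 1 ∨ ν = -1) {g₁ g₂ : V}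
    (hg₁ : g₁ ∈ S.Sel) (hg₁ν : g₁ ∈ S.part ν) (hg₂ν : g₂ ∈ S.part (-ν))
    (hg₂ : ∀ v, (∀ q, S.Kol q → v ≠ S.pl q) → g₂ ∈ S.Loc v) {T : Finset V}
    (hT : ∀ t ∈ T, t ∈ S.Sel) (hTp : ∀ t ∈ T, ∃ e : ℤ, (e = 1 ∨ e = -1) ∧ t ∈ S.part e) {g : V}
    (hg : g ∈ AddSubgroup.closure (insert g₁ (insert g₂ (T : Set V)))) (h0 : S.rK g = 0) :
    g = 0 := by
  obtain ⟨u, w, hu, huν, hwν, hw, rfl⟩ := S.exists_shape_of_mem_closure hν hg₁ hg₁ν hg₂ν hg₂ hT hTp hg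
  have hrel : S.rK u = S.rK (-w) := by
    rw [map_neg]
    exact eq_neg_of_add_eq_zero_left (by rw [← map_add]; exact h0)
  obtain ⟨hu0, hw0⟩ := S.eq_zero_of_rK_eq hν hu huν ((S.part (-ν)).neg_mem hwν)
    (fun v hv ↦ (S.Loc v).neg_mem (hw v hv)) hrel
  rw [hu0, zero_add, ← neg_neg w, hw0, neg_zero]

/-! ### The chain `n_k = ℓ₁ ⋯ ℓ_k` and the invariant (I) -/

/-- **McCallum 1991, proof of Thm. 5.4 — the chain, with invariant (I), VISIBLE data.** Under the
hypotheses of `sum_expo_le_M₀_of_casselsTate` (see the module docstring: `hCTV`, the visible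
kernel-form Čebotarev `hCeb`, Kolyvagin classes supported on Kolyvagin places `hcsupp`), for every
`k ≤ K` there is
`n = n_k ∈ S_k` (`k` prime factors) such that the later lifts `s_j`, `j > k`, vanish at every
prime of `n` (McCallum (19)/(23)) and
**(I)** `p^i c(n) ∈ ⟨s_j : k < j ≤ K⟩ ⟹ (M - M₀) + ∑_{j ≤ k} expo s_j ≤ i`.
[cite: McCallumLMS1991, Thm. 5.4 (proof, (16)–(23)), Prop. 4.7, Lemma 5.3, Prop. 3.1] -/
theorem exists_chain_of_casselsTate {R : Type*} [AddCommGroup R] (P : S.Sel →+ S.Sel →+ R)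
    (hCTV : ∀ ℓ m : ℕ, S.Kol ℓ → KolSupp S.Kol (ℓ * m) → ¬ ℓ ∣ m →
      ∀ (j N a b : ℕ) (t : V) (ht : t ∈ S.Sel) (hz : ((S.p : ℤ) ^ j) • S.c (ℓ * m) ∈ S.Sel),
      ((S.p : ℤ) ^ N) • t = 0 → t ∈ S.part (S.ε * (-1) ^ (ℓ * m).primeFactors.card) →
      (∀ q ∈ m.primeFactors, t ∈ S.A q) → S.M - S.M₀ ≤ j → N + S.M₀ ≤ S.M → N ≤ j → a + b + 1 = N →
      ((S.p : ℤ) ^ (a + (j - N))) • S.c m ∉ S.A ℓ → ((S.p : ℤ) ^ b) • t ∉ S.A ℓ →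
      P ⟨_, hz⟩ ⟨t, ht⟩ ≠ 0)
    (hCeb : ∀ (T : Finset V) (g₁ g₂ : V) (ν : ℤ), (ν = 1 ∨ ν = -1) → g₁ ∈ S.part ν →
      g₂ ∈ S.part (-ν) → (∀ t ∈ T, ∃ e : ℤ, (e = 1 ∨ e = -1) ∧ t ∈ S.part e) →
      (∀ g ∈ AddSubgroup.closure (insert g₁ (insert g₂ (T : Set V))), S.rK g = 0 → g = 0) →
      ∀ b : ℕ, ∃ ℓ, b < ℓ ∧ S.Kol ℓ ∧ (∀ t ∈ T, t ∈ S.A ℓ) ∧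
        (∀ j : ℕ, ((S.p : ℤ) ^ j) • g₁ ∈ S.A ℓ ↔
          ((S.p : ℤ) ^ j) • g₁ ∈ AddSubgroup.closure (T : Set V)) ∧
        (∀ j : ℕ, ((S.p : ℤ) ^ j) • g₂ ∈ S.A ℓ ↔
          ((S.p : ℤ) ^ j) • g₂ ∈ AddSubgroup.closure (T : Set V)))
    (hcsupp : ∀ n, KolSupp S.Kol n → ∀ v, (∀ q, S.Kol q → v ≠ S.pl q) → S.c n ∈ S.Loc v)
    (K : ℕ) (s : ℕ → V) (hsel : ∀ i, s i ∈ S.Sel)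
    (hτs : ∀ i ∈ Finset.Ioc 0 K, s i ∈ S.part (S.ε * (-1) ^ i))
    (hiso : ∀ i ∈ Finset.Ioc 0 K, ∀ i' ∈ Finset.Ioc 0 K, P ⟨s i, hsel i⟩ ⟨s i', hsel i'⟩ = 0)
    (hind : ∀ (b : ℤ) (a : ℕ → ℤ), b • S.x + ∑ i ∈ Finset.Ioc 0 K, a i • s i = 0 →
      b • S.x = 0 ∧ ∀ i ∈ Finset.Ioc 0 K, a i • s i = 0)
    (hroom : ∀ i ∈ Finset.Ioc 0 K, S.expo (s i) + S.M₀ ≤ S.M) (k : ℕ) (hk : k ≤ K) :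
    ∃ n, KolSupp S.Kol n ∧ n.primeFactors.card = k ∧
      (∀ q ∈ n.primeFactors, ∀ i ∈ Finset.Ioc k K, s i ∈ S.A q) ∧
      ∀ i : ℕ, ((S.p : ℤ) ^ i) • S.c n ∈
          AddSubgroup.closure (((Finset.Ioc k K).image s : Finset V) : Set V) →
        (S.M - S.M₀) + ∑ j ∈ Finset.Ioc 0 k, S.expo (s j) ≤ i := by
  have hp := S.hp
  -- the pools `⟨s_j : k < j ≤ K⟩` lie in `Sel`
  have hpool : ∀ k, (((Finset.Ioc k K).image s : Finset V) : Set V) ⊆ S.Sel := by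
    intro k v hv
    rw [Finset.coe_image, Set.mem_image] at hv
    obtain ⟨i, -, rfl⟩ := hv
    exact hsel i
  induction k with
  | zero =>
    refine ⟨1, kolSupp_one _, by simp, by simp, fun i hi ↦ ?_⟩
    rw [S.c_one, smul_smul, ← pow_add] at hi
    have h0 := S.zsmul_x_eq_zero_of_mem_closure_Ioc hind hi
    rw [S.zsmul_x_eq_zero_iff', ← Nat.cast_pow, ← Nat.cast_pow, Int.natCast_dvd_natCast,
      Nat.pow_dvd_pow_iff_le_right hp.one_lt] at h0
    simp only [Finset.Ioc_self, Finset.sum_empty, add_zero]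
    omega
  | succ k ih =>
    obtain ⟨n, hn, hcard, hA, hI⟩ := ih (by omega)
    have hn0 : n ≠ 0 := hn.1.ne_zero
    have hk1 : k + 1 ∈ Finset.Ioc 0 K := by simp only [Finset.mem_Ioc]; omega
    have hk1' : k + 1 ∈ Finset.Ioc k K := by simp only [Finset.mem_Ioc]; omega
    -- signs: `s_{k+1} ∈ V^{ν}`, `c(n_k) ∈ V^{-ν}`, `ν = ε (-1)^{k+1}`
    set ν : ℤ := S.ε * (-1) ^ (k + 1) with hν
    have hν1 : ν = 1 ∨ ν = -1 := S.sign_pow_cases' (k + 1)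
    have hτs' : s (k + 1) ∈ S.part ν := hτs (k + 1) hk1
    have hτc : S.c n ∈ S.part (-ν) := by
      have h := S.c_part n hn
      rwa [hcard, show S.ε * (-1) ^ k = -ν by rw [hν, pow_succ]; ring] at h
    set T : Finset V := (Finset.Ioc (k + 1) K).image s with hT
    have hTτ : ∀ t ∈ T, ∃ e : ℤ, (e = 1 ∨ e = -1) ∧ t ∈ S.part e := by
      intro t ht
      rw [hT, Finset.mem_image] at ht
      obtain ⟨i, hi, rfl⟩ := ht
      refine ⟨_, S.sign_pow_cases' i, hτs i ?_⟩
      simp only [Finset.mem_Ioc] at hi ⊢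
      omega
    -- the sub-pool `⟨T⟩ ≤ ⟨s_j : k < j⟩`
    have hTsub : (T : Set V) ⊆ (((Finset.Ioc k K).image s : Finset V) : Set V) := by
      rw [hT, Finset.coe_image, Finset.coe_image]
      apply Set.image_mono
      intro i hi
      simp only [Finset.coe_Ioc, Set.mem_Ioc] at hi ⊢
      omega
    -- ### the Kolyvagin prime `ℓ = ℓ_{k+1}` (McCallum (21)–(23))
    have hTsel : ∀ t ∈ T, t ∈ S.Sel := fun t ht ↦ hpool (k + 1) (hT ▸ ht)
    have hvis : ∀ g ∈ AddSubgroup.closure (insert (s (k + 1)) (insert (S.c n) (T : Set V))),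
        S.rK g = 0 → g = 0 := fun g hg hg0 ↦
      S.eq_zero_of_mem_closure_of_rK_eq_zero hν1 (hsel (k + 1)) hτs' hτc
        (fun v hv ↦ hcsupp n hn v hv) hTsel hTτ hg hg0
    obtain ⟨ℓ, hℓn, hℓ, hTA, hray₁, hray₂⟩ := hCeb T (s (k + 1)) (S.c n) ν hν1 hτs' hτc hTτ hvis n
    have hℓp := S.prime_of_kol ℓ hℓ
    have hndvd : ¬ ℓ ∣ n := fun h ↦ by
      have := Nat.le_of_dvd (Nat.pos_of_ne_zero hn0) h
      omega
    have hsupp : KolSupp S.Kol (ℓ * n) := S.kolSupp_mul_of_not_dvd hℓ hn hndvd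
    have hcard' : (ℓ * n).primeFactors.card = k + 1 := by
      rw [card_primeFactors_mul_of_not_dvd hℓp hn0 hndvd, hcard]
    -- Fact B: `p^{i'} c(n)_λ = 0 ⟹ i' ≥ (M - M₀) + ∑_{j ≤ k} N_j` (from (I) at `k`)
    have hB : ∀ i' : ℕ, ((S.p : ℤ) ^ i') • S.c n ∈ S.A ℓ →
        (S.M - S.M₀) + ∑ j ∈ Finset.Ioc 0 k, S.expo (s j) ≤ i' := fun i' hi' ↦
      hI i' (AddSubgroup.closure_mono hTsub ((hray₂ i').mp hi'))
    refine ⟨ℓ * n, hsupp, hcard', fun q hq i hi ↦ ?_, fun i hi ↦ ?_⟩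
    · -- (19)/(23): the later lifts vanish at the primes of `ℓ n`
      rw [Nat.primeFactors_mul hℓp.ne_zero hn0, Finset.mem_union, hℓp.primeFactors,
        Finset.mem_singleton] at hq
      rcases hq with rfl | hq
      · have hmemT : s i ∈ (T : Set V) := by
          rw [hT, Finset.coe_image]
          exact Set.mem_image_of_mem _ (by simpa using hi)
        exact hTA (s i) hmemT
      · refine hA q hq i ?_
        simp only [Finset.mem_Ioc] at hi ⊢
        omega
    · -- ### the invariant (I) at `k + 1`
      rw [Finset.sum_Ioc_succ_top (Nat.zero_le k), ← add_assoc]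
      have hSel : ((S.p : ℤ) ^ i) • S.c (ℓ * n) ∈ S.Sel :=
        (AddSubgroup.closure_le _).mpr ((hT ▸ hpool (k + 1))) hi
      have hAℓ : ((S.p : ℤ) ^ i) • S.c n ∈ S.A ℓ :=
        (S.c_mem_loc_iff ℓ n hℓ hsupp i).mp ((S.mem_sel_iff _).mp hSel (S.pl ℓ))
      have hB0 := hB i hAℓ
      by_cases hN : S.expo (s (k + 1)) = 0
      · rw [hN]
        omega
      by_contra hlt
      push Not at hlt
      have hNi : S.expo (s (k + 1)) ≤ i := by
        have := hroom (k + 1) hk1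
        omega
      -- (21): `p^{i - N} c(n)_λ ≠ 0`
      have hnot : ((S.p : ℤ) ^ (0 + (i - S.expo (s (k + 1))))) • S.c n ∉ S.A ℓ := by
        intro h
        rw [zero_add] at h
        have := hB _ h
        omega
      -- (22): `s_{k+1}` has full order at `λ`
      have hsfull : ((S.p : ℤ) ^ (S.expo (s (k + 1)) - 1)) • s (k + 1) ∉ S.A ℓ := by
        intro h
        have hT' := (hray₁ _).mp h
        exact S.pow_expo_sub_one_zsmul_ne_zero' hN
          (S.zsmul_eq_zero_of_mem_closure_Ioc hind hk1 (hT ▸ hT'))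
      have hτsk : s (k + 1) ∈ S.part (S.ε * (-1) ^ (ℓ * n).primeFactors.card) := by
        rw [hcard']
        exact hτs'
      have hAq : ∀ q ∈ n.primeFactors, s (k + 1) ∈ S.A q := fun q hq ↦ hA q hq (k + 1) hk1'
      have hne := hCTV ℓ n hℓ hsupp hndvd i (S.expo (s (k + 1))) 0 (S.expo (s (k + 1)) - 1)
        (s (k + 1)) (hsel _) hSel (S.pow_expo_zsmul' _) hτsk hAq (by omega) (hroom (k + 1) hk1) hNi
        (by omega) hnot
        hsfull
      -- isotropy of `⟨T⟩ ∋ p^i c(n_{k+1})` with `s_{k+1}`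
      refine hne (S.pairing_eq_zero_of_mem_closure P (hT ▸ hpool (k + 1)) (hsel (k + 1))
        (fun w hw ↦ ?_) hi hSel)
      rw [hT, Finset.coe_image, Set.mem_image] at hw
      obtain ⟨i', hi', rfl⟩ := hw
      refine hiso i' ?_ (k + 1) hk1
      simp only [Finset.coe_Ioc, Set.mem_Ioc, Finset.mem_Ioc] at hi' ⊢
      omega

/-! ### Kolyvagin's inequality `∑ Nᵢ ≤ M₀` -/

/-- **Kolyvagin's bound on the order of `Ш_{p^∞}` (McCallum 1991, §1 Theorem with Thm. 5.4 "≤"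
and Cor. 5.6), telescope form, VISIBLE data.** Let `S` be visible descent data modulo `p^M` and let
`s₁, …, s_K ∈ Sel = S_{p^M}(E/K)` be `τ`-eigenclasses, `τ sᵢ = ε(-1)ⁱ sᵢ`, independent together
with `x` (so that their images in `Ш(E/K)_{p^M} = Sel/ℤx` span `⊕ ⟨s̄ᵢ⟩` with `ord s̄ᵢ = ord sᵢ`),
pairwise isotropic for the bi-additive pairing `P` on `Sel` (the Cassels–Tate pairing pulled back
to `Sel`), with `ord sᵢ · p^{M₀} ∣ p^M`. Assume McCallum's Prop. 4.7 / Lemma 5.3 / Prop. 4.4 in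
order language (`hCTV`, the non-vanishing of the Cassels–Tate value `⟨d_{M-j}(ℓm), d⟩` at the one
surviving place `λ`), Prop. 3.1 in visible kernel form (`hCeb`: two rays, for spans on which `rK`
is injective — McCallum p. 299) and Lemma 4.3 for all square-free `n` (`hcsupp`). Then
**`∑ᵢ ord_p(ord sᵢ) ≤ M₀ = ord_p [E(K) : ℤ y_K]`** — for the lifts of a maximal isotropic
`D = ⊕ Dᵢ` of `Ш(E/K)_{p^∞}` (McCallum p. 288) this is `∑ Nᵢ ≤ M₀`, i.e.
`#Ш(E/K)_{p^∞} = (#D)² ≤ p^{2M₀}`. The proof is McCallum's induction (Thm. 5.4) run with the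
invariant (I) of `exists_chain_of_casselsTate` instead of the optimality (20), so that Prop. 5.2
is not needed for the inequality.
[cite: McCallumLMS1991, §1 Theorem; Thm. 5.4 (proof), Cor. 5.6; Prop. 3.1, Prop. 4.7, Lemma 5.3] -/
theorem sum_expo_le_M₀_of_casselsTate {R : Type*} [AddCommGroup R] (P : S.Sel →+ S.Sel →+ R)
    (hCTV : ∀ ℓ m : ℕ, S.Kol ℓ → KolSupp S.Kol (ℓ * m) → ¬ ℓ ∣ m →
      ∀ (j N a b : ℕ) (t : V) (ht : t ∈ S.Sel) (hz : ((S.p : ℤ) ^ j) • S.c (ℓ * m) ∈ S.Sel),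
      ((S.p : ℤ) ^ N) • t = 0 → t ∈ S.part (S.ε * (-1) ^ (ℓ * m).primeFactors.card) →
      (∀ q ∈ m.primeFactors, t ∈ S.A q) → S.M - S.M₀ ≤ j → N + S.M₀ ≤ S.M → N ≤ j → a + b + 1 = N →
      ((S.p : ℤ) ^ (a + (j - N))) • S.c m ∉ S.A ℓ → ((S.p : ℤ) ^ b) • t ∉ S.A ℓ →
      P ⟨_, hz⟩ ⟨t, ht⟩ ≠ 0)
    (hCeb : ∀ (T : Finset V) (g₁ g₂ : V) (ν : ℤ), (ν = 1 ∨ ν = -1) → g₁ ∈ S.part ν →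
      g₂ ∈ S.part (-ν) → (∀ t ∈ T, ∃ e : ℤ, (e = 1 ∨ e = -1) ∧ t ∈ S.part e) →
      (∀ g ∈ AddSubgroup.closure (insert g₁ (insert g₂ (T : Set V))), S.rK g = 0 → g = 0) →
      ∀ b : ℕ, ∃ ℓ, b < ℓ ∧ S.Kol ℓ ∧ (∀ t ∈ T, t ∈ S.A ℓ) ∧
        (∀ j : ℕ, ((S.p : ℤ) ^ j) • g₁ ∈ S.A ℓ ↔
          ((S.p : ℤ) ^ j) • g₁ ∈ AddSubgroup.closure (T : Set V)) ∧
        (∀ j : ℕ, ((S.p : ℤ) ^ j) • g₂ ∈ S.A ℓ ↔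
          ((S.p : ℤ) ^ j) • g₂ ∈ AddSubgroup.closure (T : Set V)))
    (hcsupp : ∀ n, KolSupp S.Kol n → ∀ v, (∀ q, S.Kol q → v ≠ S.pl q) → S.c n ∈ S.Loc v)
    (K : ℕ) (s : ℕ → V) (hsel : ∀ i, s i ∈ S.Sel)
    (hτs : ∀ i ∈ Finset.Ioc 0 K, s i ∈ S.part (S.ε * (-1) ^ i))
    (hiso : ∀ i ∈ Finset.Ioc 0 K, ∀ i' ∈ Finset.Ioc 0 K, P ⟨s i, hsel i⟩ ⟨s i', hsel i'⟩ = 0)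
    (hind : ∀ (b : ℤ) (a : ℕ → ℤ), b • S.x + ∑ i ∈ Finset.Ioc 0 K, a i • s i = 0 →
      b • S.x = 0 ∧ ∀ i ∈ Finset.Ioc 0 K, a i • s i = 0)
    (hroom : ∀ i ∈ Finset.Ioc 0 K, S.expo (s i) + S.M₀ ≤ S.M) :
    ∑ i ∈ Finset.Ioc 0 K, S.expo (s i) ≤ S.M₀ := by
  obtain ⟨n, -, -, -, hI⟩ :=
    S.exists_chain_of_casselsTate P hCTV hCeb hcsupp K s hsel hτs hiso hind hroom K le_rfl
  have := hI S.M (by rw [S.torsion]; exact zero_mem _)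
  omega

/-! ### The same chain and inequality with the value formula restricted to `p^{2M₀}`-torsion `t`

Appended by the BSD route `GenusKolyvaginAtTwo` (seat `bsd-line-gk2-p2` g12). In the induction of
`exists_chain_of_casselsTate` the value formula `hCTV` is only ever applied to `t = s_{k+1}`, a Selmer
eigenclass INDEPENDENT of `x`; such a class is killed by `p^{2M₀}` (Claim B for the `ε`-part,
`claimB_indep`; Claim A, `p^{M₀}`, for the `-ε`-part). The Cassels–Tate pairing pulled back to
`S_{p^M}` satisfies the value formula only for such `t` (a class with a large `x`-component has the
same image in `Ш` as a small one but different local orders), so the consumers that DISCHARGE `hCTV`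
need the hypothesis in this restricted form: the extra antecedent `p^{2M₀} t = 0`. -/

/-- **McCallum 1991, proof of Thm. 5.4 — the chain with invariant (I), VISIBLE data, value formula on
`p^{2M₀}`-torsion classes only.** As `exists_chain_of_casselsTate`, with `hCTV` assumed only for `t` with
`p^{2M₀} t = 0`; at the point of use `t = s_{k+1}` is independent of `x` (`hind`), hence killed by
`p^{2M₀}` (`claimA` / `claimB_indep`). [cite: McCallumLMS1991, Thm. 5.4 (proof, (16)–(23)), Prop. 4.7, Lemma 5.3, Prop. 3.1] -/
theorem exists_chain_of_casselsTate_of_torsion {R : Type*} [AddCommGroup R] (P : S.Sel →+ S.Sel →+ R)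
    (hCTV : ∀ ℓ m : ℕ, S.Kol ℓ → KolSupp S.Kol (ℓ * m) → ¬ ℓ ∣ m →
      ∀ (j N a b : ℕ) (t : V) (ht : t ∈ S.Sel) (hz : ((S.p : ℤ) ^ j) • S.c (ℓ * m) ∈ S.Sel),
      ((S.p : ℤ) ^ N) • t = 0 → ((S.p : ℤ) ^ (2 * S.M₀)) • t = 0 →
      t ∈ S.part (S.ε * (-1) ^ (ℓ * m).primeFactors.card) →
      (∀ q ∈ m.primeFactors, t ∈ S.A q) → S.M - S.M₀ ≤ j → N + S.M₀ ≤ S.M → N ≤ j → a + b + 1 = N →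
      ((S.p : ℤ) ^ (a + (j - N))) • S.c m ∉ S.A ℓ → ((S.p : ℤ) ^ b) • t ∉ S.A ℓ →
      P ⟨_, hz⟩ ⟨t, ht⟩ ≠ 0)
    (hCeb : ∀ (T : Finset V) (g₁ g₂ : V) (ν : ℤ), (ν = 1 ∨ ν = -1) → g₁ ∈ S.part ν →
      g₂ ∈ S.part (-ν) → (∀ t ∈ T, ∃ e : ℤ, (e = 1 ∨ e = -1) ∧ t ∈ S.part e) →
      (∀ g ∈ AddSubgroup.closure (insert g₁ (insert g₂ (T : Set V))), S.rK g = 0 → g = 0) →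
      ∀ b : ℕ, ∃ ℓ, b < ℓ ∧ S.Kol ℓ ∧ (∀ t ∈ T, t ∈ S.A ℓ) ∧
        (∀ j : ℕ, ((S.p : ℤ) ^ j) • g₁ ∈ S.A ℓ ↔
          ((S.p : ℤ) ^ j) • g₁ ∈ AddSubgroup.closure (T : Set V)) ∧
        (∀ j : ℕ, ((S.p : ℤ) ^ j) • g₂ ∈ S.A ℓ ↔
          ((S.p : ℤ) ^ j) • g₂ ∈ AddSubgroup.closure (T : Set V)))
    (hcsupp : ∀ n, KolSupp S.Kol n → ∀ v, (∀ q, S.Kol q → v ≠ S.pl q) → S.c n ∈ S.Loc v)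
    (K : ℕ) (s : ℕ → V) (hsel : ∀ i, s i ∈ S.Sel)
    (hτs : ∀ i ∈ Finset.Ioc 0 K, s i ∈ S.part (S.ε * (-1) ^ i))
    (hiso : ∀ i ∈ Finset.Ioc 0 K, ∀ i' ∈ Finset.Ioc 0 K, P ⟨s i, hsel i⟩ ⟨s i', hsel i'⟩ = 0)
    (hind : ∀ (b : ℤ) (a : ℕ → ℤ), b • S.x + ∑ i ∈ Finset.Ioc 0 K, a i • s i = 0 →
      b • S.x = 0 ∧ ∀ i ∈ Finset.Ioc 0 K, a i • s i = 0)
    (hroom : ∀ i ∈ Finset.Ioc 0 K, S.expo (s i) + S.M₀ ≤ S.M) (k : ℕ) (hk : k ≤ K) :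
    ∃ n, KolSupp S.Kol n ∧ n.primeFactors.card = k ∧
      (∀ q ∈ n.primeFactors, ∀ i ∈ Finset.Ioc k K, s i ∈ S.A q) ∧
      ∀ i : ℕ, ((S.p : ℤ) ^ i) • S.c n ∈
          AddSubgroup.closure (((Finset.Ioc k K).image s : Finset V) : Set V) →
        (S.M - S.M₀) + ∑ j ∈ Finset.Ioc 0 k, S.expo (s j) ≤ i := by
  have hp := S.hp
  -- the pools `⟨s_j : k < j ≤ K⟩` lie in `Sel`
  have hpool : ∀ k, (((Finset.Ioc k K).image s : Finset V) : Set V) ⊆ S.Sel := by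
    intro k v hv
    rw [Finset.coe_image, Set.mem_image] at hv
    obtain ⟨i, -, rfl⟩ := hv
    exact hsel i
  induction k with
  | zero =>
    refine ⟨1, kolSupp_one _, by simp, by simp, fun i hi ↦ ?_⟩
    rw [S.c_one, smul_smul, ← pow_add] at hi
    have h0 := S.zsmul_x_eq_zero_of_mem_closure_Ioc hind hi
    rw [S.zsmul_x_eq_zero_iff', ← Nat.cast_pow, ← Nat.cast_pow, Int.natCast_dvd_natCast,
      Nat.pow_dvd_pow_iff_le_right hp.one_lt] at h0
    simp only [Finset.Ioc_self, Finset.sum_empty, add_zero]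
    omega
  | succ k ih =>
    obtain ⟨n, hn, hcard, hA, hI⟩ := ih (by omega)
    have hn0 : n ≠ 0 := hn.1.ne_zero
    have hk1 : k + 1 ∈ Finset.Ioc 0 K := by simp only [Finset.mem_Ioc]; omega
    have hk1' : k + 1 ∈ Finset.Ioc k K := by simp only [Finset.mem_Ioc]; omega
    -- signs: `s_{k+1} ∈ V^{ν}`, `c(n_k) ∈ V^{-ν}`, `ν = ε (-1)^{k+1}`
    set ν : ℤ := S.ε * (-1) ^ (k + 1) with hν
    have hν1 : ν = 1 ∨ ν = -1 := S.sign_pow_cases' (k + 1)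
    have hτs' : s (k + 1) ∈ S.part ν := hτs (k + 1) hk1
    have hτc : S.c n ∈ S.part (-ν) := by
      have h := S.c_part n hn
      rwa [hcard, show S.ε * (-1) ^ k = -ν by rw [hν, pow_succ]; ring] at h
    set T : Finset V := (Finset.Ioc (k + 1) K).image s with hT
    have hTτ : ∀ t ∈ T, ∃ e : ℤ, (e = 1 ∨ e = -1) ∧ t ∈ S.part e := by
      intro t ht
      rw [hT, Finset.mem_image] at ht
      obtain ⟨i, hi, rfl⟩ := ht
      refine ⟨_, S.sign_pow_cases' i, hτs i ?_⟩
      simp only [Finset.mem_Ioc] at hi ⊢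
      omega
    -- the sub-pool `⟨T⟩ ≤ ⟨s_j : k < j⟩`
    have hTsub : (T : Set V) ⊆ (((Finset.Ioc k K).image s : Finset V) : Set V) := by
      rw [hT, Finset.coe_image, Finset.coe_image]
      apply Set.image_mono
      intro i hi
      simp only [Finset.coe_Ioc, Set.mem_Ioc] at hi ⊢
      omega
    -- ### the Kolyvagin prime `ℓ = ℓ_{k+1}` (McCallum (21)–(23))
    have hTsel : ∀ t ∈ T, t ∈ S.Sel := fun t ht ↦ hpool (k + 1) (hT ▸ ht)
    have hvis : ∀ g ∈ AddSubgroup.closure (insert (s (k + 1)) (insert (S.c n) (T : Set V))),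
        S.rK g = 0 → g = 0 := fun g hg hg0 ↦
      S.eq_zero_of_mem_closure_of_rK_eq_zero hν1 (hsel (k + 1)) hτs' hτc
        (fun v hv ↦ hcsupp n hn v hv) hTsel hTτ hg hg0
    obtain ⟨ℓ, hℓn, hℓ, hTA, hray₁, hray₂⟩ := hCeb T (s (k + 1)) (S.c n) ν hν1 hτs' hτc hTτ hvis n
    have hℓp := S.prime_of_kol ℓ hℓ
    have hndvd : ¬ ℓ ∣ n := fun h ↦ by
      have := Nat.le_of_dvd (Nat.pos_of_ne_zero hn0) h
      omega
    have hsupp : KolSupp S.Kol (ℓ * n) := S.kolSupp_mul_of_not_dvd hℓ hn hndvd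
    have hcard' : (ℓ * n).primeFactors.card = k + 1 := by
      rw [card_primeFactors_mul_of_not_dvd hℓp hn0 hndvd, hcard]
    -- Fact B: `p^{i'} c(n)_λ = 0 ⟹ i' ≥ (M - M₀) + ∑_{j ≤ k} N_j` (from (I) at `k`)
    have hB : ∀ i' : ℕ, ((S.p : ℤ) ^ i') • S.c n ∈ S.A ℓ →
        (S.M - S.M₀) + ∑ j ∈ Finset.Ioc 0 k, S.expo (s j) ≤ i' := fun i' hi' ↦
      hI i' (AddSubgroup.closure_mono hTsub ((hray₂ i').mp hi'))
    refine ⟨ℓ * n, hsupp, hcard', fun q hq i hi ↦ ?_, fun i hi ↦ ?_⟩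
    · -- (19)/(23): the later lifts vanish at the primes of `ℓ n`
      rw [Nat.primeFactors_mul hℓp.ne_zero hn0, Finset.mem_union, hℓp.primeFactors,
        Finset.mem_singleton] at hq
      rcases hq with rfl | hq
      · have hmemT : s i ∈ (T : Set V) := by
          rw [hT, Finset.coe_image]
          exact Set.mem_image_of_mem _ (by simpa using hi)
        exact hTA (s i) hmemT
      · refine hA q hq i ?_
        simp only [Finset.mem_Ioc] at hi ⊢
        omega
    · -- ### the invariant (I) at `k + 1`
      rw [Finset.sum_Ioc_succ_top (Nat.zero_le k), ← add_assoc]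
      have hSel : ((S.p : ℤ) ^ i) • S.c (ℓ * n) ∈ S.Sel :=
        (AddSubgroup.closure_le _).mpr ((hT ▸ hpool (k + 1))) hi
      have hAℓ : ((S.p : ℤ) ^ i) • S.c n ∈ S.A ℓ :=
        (S.c_mem_loc_iff ℓ n hℓ hsupp i).mp ((S.mem_sel_iff _).mp hSel (S.pl ℓ))
      have hB0 := hB i hAℓ
      by_cases hN : S.expo (s (k + 1)) = 0
      · rw [hN]
        omega
      by_contra hlt
      push Not at hlt
      have hNi : S.expo (s (k + 1)) ≤ i := by
        have := hroom (k + 1) hk1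
        omega
      -- (21): `p^{i - N} c(n)_λ ≠ 0`
      have hnot : ((S.p : ℤ) ^ (0 + (i - S.expo (s (k + 1))))) • S.c n ∉ S.A ℓ := by
        intro h
        rw [zero_add] at h
        have := hB _ h
        omega
      -- (22): `s_{k+1}` has full order at `λ`
      have hsfull : ((S.p : ℤ) ^ (S.expo (s (k + 1)) - 1)) • s (k + 1) ∉ S.A ℓ := by
        intro h
        have hT' := (hray₁ _).mp h
        exact S.pow_expo_sub_one_zsmul_ne_zero' hN
          (S.zsmul_eq_zero_of_mem_closure_Ioc hind hk1 (hT ▸ hT'))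
      have hτsk : s (k + 1) ∈ S.part (S.ε * (-1) ^ (ℓ * n).primeFactors.card) := by
        rw [hcard']
        exact hτs'
      have hAq : ∀ q ∈ n.primeFactors, s (k + 1) ∈ S.A q := fun q hq ↦ hA q hq (k + 1) hk1'
      -- the extra antecedent: `s_{k+1}` is independent of `x`, hence killed by `p^{2M₀}` (Claims A/B)
      have hind1 : ∀ a₀ a₁ : ℤ, a₀ • S.x + a₁ • s (k + 1) = 0 → a₁ • s (k + 1) = 0 := by
        intro a₀ a₁ h
        have h' := (hind a₀ (fun i ↦ if i = k + 1 then a₁ else 0) (by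
          rw [Finset.sum_eq_single (k + 1) (fun i _ hi ↦ by rw [if_neg hi, zero_smul])
            (fun hk ↦ (hk hk1).elim), if_pos rfl]
          exact h)).2 (k + 1) hk1
        rwa [if_pos rfl] at h'
      have hkill2 : ((S.p : ℤ) ^ (2 * S.M₀)) • s (k + 1) = 0 := by
        rcases S.hε with hε | hε <;> rcases hν1 with hν' | hν'
        · exact S.claimB_indep (hsel _) (by rw [hε, ← hν']; exact hτs') hind1
        · rw [two_mul, pow_add, mul_smul, S.claimA (hsel _) (by rw [hε, ← hν']; exact hτs'), smul_zero]
        · rw [two_mul, pow_add, mul_smul,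
            S.claimA (hsel _) (by rw [hε, neg_neg, ← hν']; exact hτs'), smul_zero]
        · exact S.claimB_indep (hsel _) (by rw [hε, ← hν']; exact hτs') hind1
      have hne := hCTV ℓ n hℓ hsupp hndvd i (S.expo (s (k + 1))) 0 (S.expo (s (k + 1)) - 1)
        (s (k + 1)) (hsel _) hSel (S.pow_expo_zsmul' _) hkill2 hτsk hAq (by omega) (hroom (k + 1) hk1)
        hNi (by omega) hnot
        hsfull
      -- isotropy of `⟨T⟩ ∋ p^i c(n_{k+1})` with `s_{k+1}`
      refine hne (S.pairing_eq_zero_of_mem_closure P (hT ▸ hpool (k + 1)) (hsel (k + 1))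
        (fun w hw ↦ ?_) hi hSel)
      rw [hT, Finset.coe_image, Set.mem_image] at hw
      obtain ⟨i', hi', rfl⟩ := hw
      refine hiso i' ?_ (k + 1) hk1
      simp only [Finset.coe_Ioc, Set.mem_Ioc, Finset.mem_Ioc] at hi' ⊢
      omega

/-- **Kolyvagin's inequality `∑ᵢ ord_p(ord sᵢ) ≤ M₀`, VISIBLE data, value formula on `p^{2M₀}`-torsion
classes only.** As `sum_expo_le_M₀_of_casselsTate`, with the restricted `hCTV` of
`exists_chain_of_casselsTate_of_torsion`. [cite: McCallumLMS1991, §1 Theorem; Thm. 5.4 (proof), Cor. 5.6; Prop. 3.1, Prop. 4.7, Lemma 5.3] -/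
theorem sum_expo_le_M₀_of_casselsTate_of_torsion {R : Type*} [AddCommGroup R] (P : S.Sel →+ S.Sel →+ R)
    (hCTV : ∀ ℓ m : ℕ, S.Kol ℓ → KolSupp S.Kol (ℓ * m) → ¬ ℓ ∣ m →
      ∀ (j N a b : ℕ) (t : V) (ht : t ∈ S.Sel) (hz : ((S.p : ℤ) ^ j) • S.c (ℓ * m) ∈ S.Sel),
      ((S.p : ℤ) ^ N) • t = 0 → ((S.p : ℤ) ^ (2 * S.M₀)) • t = 0 →
      t ∈ S.part (S.ε * (-1) ^ (ℓ * m).primeFactors.card) →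
      (∀ q ∈ m.primeFactors, t ∈ S.A q) → S.M - S.M₀ ≤ j → N + S.M₀ ≤ S.M → N ≤ j → a + b + 1 = N →
      ((S.p : ℤ) ^ (a + (j - N))) • S.c m ∉ S.A ℓ → ((S.p : ℤ) ^ b) • t ∉ S.A ℓ →
      P ⟨_, hz⟩ ⟨t, ht⟩ ≠ 0)
    (hCeb : ∀ (T : Finset V) (g₁ g₂ : V) (ν : ℤ), (ν = 1 ∨ ν = -1) → g₁ ∈ S.part ν →
      g₂ ∈ S.part (-ν) → (∀ t ∈ T, ∃ e : ℤ, (e = 1 ∨ e = -1) ∧ t ∈ S.part e) →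
      (∀ g ∈ AddSubgroup.closure (insert g₁ (insert g₂ (T : Set V))), S.rK g = 0 → g = 0) →
      ∀ b : ℕ, ∃ ℓ, b < ℓ ∧ S.Kol ℓ ∧ (∀ t ∈ T, t ∈ S.A ℓ) ∧
        (∀ j : ℕ, ((S.p : ℤ) ^ j) • g₁ ∈ S.A ℓ ↔
          ((S.p : ℤ) ^ j) • g₁ ∈ AddSubgroup.closure (T : Set V)) ∧
        (∀ j : ℕ, ((S.p : ℤ) ^ j) • g₂ ∈ S.A ℓ ↔
          ((S.p : ℤ) ^ j) • g₂ ∈ AddSubgroup.closure (T : Set V)))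
    (hcsupp : ∀ n, KolSupp S.Kol n → ∀ v, (∀ q, S.Kol q → v ≠ S.pl q) → S.c n ∈ S.Loc v)
    (K : ℕ) (s : ℕ → V) (hsel : ∀ i, s i ∈ S.Sel)
    (hτs : ∀ i ∈ Finset.Ioc 0 K, s i ∈ S.part (S.ε * (-1) ^ i))
    (hiso : ∀ i ∈ Finset.Ioc 0 K, ∀ i' ∈ Finset.Ioc 0 K, P ⟨s i, hsel i⟩ ⟨s i', hsel i'⟩ = 0)
    (hind : ∀ (b : ℤ) (a : ℕ → ℤ), b • S.x + ∑ i ∈ Finset.Ioc 0 K, a i • s i = 0 →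
      b • S.x = 0 ∧ ∀ i ∈ Finset.Ioc 0 K, a i • s i = 0)
    (hroom : ∀ i ∈ Finset.Ioc 0 K, S.expo (s i) + S.M₀ ≤ S.M) :
    ∑ i ∈ Finset.Ioc 0 K, S.expo (s i) ≤ S.M₀ := by
  obtain ⟨n, -, -, -, hI⟩ :=
    S.exists_chain_of_casselsTate_of_torsion P hCTV hCeb hcsupp K s hsel hτs hiso hind hroom K le_rfl
  have := hI S.M (by rw [S.torsion]; exact zero_mem _)
  omega

end VisibleSplitHypothesesM

end KolyvaginDescent

end Literature.NumberTheory.EllipticCurves
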